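import Summits.Ventures.CertifiedManyBodySolver.Downfold.EmeryMarginLevers
import Summits.Ventures.CertifiedManyBodySolver.Downfold.EmeryShapeTwoRayRule
import HarnessLib

/-!
# THE TRUE-CORNER RULE FOR OBJECT E: under two box-wide margin inequalities the fixed-doping one-band `t′/t` of EVERY member of a typed three-band box lies
# between its values at the two TRUE corners `(Δ₁, a₁, b₂, c₂)` and `(Δ₂, a₂, b₁, c₁)` — no virtual-corner inflation (INFL-3to1-B §B.87 (e)–(g))

Venture CertifiedManyBodySolver, cell `pub/hubbard-downfold` (stage S1; INFLATION-RULES-3to1-B §B.87), seat hubbard-downfold-mod-4 (technique B = band level,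
g35); namespace `Summit.Ventures.CertifiedManyBodySolver.Downfold.Emery`. Everything PROVED (0 sorry, no definition). WHAT THIS IS NOT: a statement about any
material; `U = 0` one-body kinematics of the σ (d–p_x–p_y + t_pp, t_pp′) model; no number lives here.

`EmeryShapeTwoRayRule` (§B.86) bounds object E over a box by two VIRTUAL corners because only rays in the oxygen plane were signed. `EmeryMarginLevers` (§B.87
(a)–(d)) signs `t_pp` at fixed `t_pp′` and `t_pp′` at fixed `t_pp` under ONE rational margin inequality each. Chaining the Δ-lever (§B.83 (g)), the `t_pd` lever
(§B.85 (e)) and the two margin levers along the coordinate axes gives: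

* §1 monotonicity helpers for the weights (`fsD_anti_tppP_at`, `fsN_mono_tpp_at`, `fsN_mono_tppP_at`) and a LOWER bound of the doping discriminant over a
  `(t_pp, t_pp′)`-box at equal energies (`dopingDisc_ge_boxLower`; the upper bound is `dopingDisc_le_slabBound`, §B.85 (n)); certificate-free `fermiEnergyOf_mono_tpp'`.
* §2 **LOWER TRUE CORNER** (`fsRatio_fermiEnergyOf_trueCorner_lower`): for every member `θ` of `[Δ₁, Δ₂] × [a₁, a₂] × [b₁, b₂] × [c₁, c₂]`,
  **`R(Δ₁, a₁, b₂, c₂) ≤ R(θ)`**, given a window `[pL, qL] ⊇ [ε_F(Δ₁, a₁, b₁, c₂), ε_F(Δ₁, a₁, b₂, c₁)]` (two point brackets), the regime `c₂(Δ₁ + 2qL) ≤ a₁²`, and two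
  margins in CLOSED FORM at the window ends (uniform over the `(t_pp, t_pp′)`-slab at `(Δ₁, a₁)` by the monotone bounds of §1):
  `4M_b·T_max² ≤ 2a₁²(Δ₁ + pL)(a₁² − c₂qL)·T_min²` and `4M_c·T_max·T(V; qL) ≤ K_min·T(V; pL)²` (`V = (Δ₁, a₁, b₂, c₂)`).
* §3 **UPPER TRUE CORNER** (`fsRatio_fermiEnergyOf_trueCorner_upper`): symmetrically **`R(θ) ≤ R(Δ₂, a₂, b₁, c₁)`** from a window
  `[pU, qU] ⊇ [ε_F(Δ₂, a₂, b₁, c₂), ε_F(Δ₂, a₂, b₂, c₁)]`, the regime, the box top `ε_F(Δ₁, a₂, b₂, c₁) ≤ qT` with `c₂qT ≤ a₁²`, and two margins.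
* READING: the margins compare the fixed-energy slope of the shape with `4·|dopingDisc|/T²` times the 4-Lipschitz oxygen moduli of the Fermi energy; on the typed
  cuprate boxes they hold with room (La₂CuO₄: factor ≈ 1.8 at the oxygen-rich slab, trivially at the V_hi side where the discriminant is `≈ −2`). With them the box's
  object-E window is read at its two TRUE corners from two point brackets — the explicit 3 → 1 inflation of §B.86 (f) is GONE (instance `EmeryBoxesLa214TrueCorners`).

Sources: three-band model [HybertsenSchluterChristensen1989, Eq. (1)]; contour form [AndersenEtAl1995, §6]; arithmetic [folklore].
-/

noncomputable section

namespace Summit.Ventures.CertifiedManyBodySolver.Downfold.Emery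

open Real Set

/-! ## §1 Helpers -/

/-- `fsD` is non-increasing in `t_pp′` at fixed energy `e ≥ 0` (`Δ + e ≥ 0`). [folklore] -/
theorem fsD_anti_tppP_at {Δ a c c' e : ℝ} (hcc : c ≤ c') (he : 0 ≤ e) (hΔe : 0 ≤ Δ + e) : fsD Δ a c' e ≤ fsD Δ a c e := by
  unfold fsD; exact mul_le_mul_of_nonneg_left (by nlinarith) hΔe

/-- `fsN` is non-decreasing in `t_pp` at fixed energy `e ≥ 0` (`0 ≤ b`). [folklore] -/
theorem fsN_mono_tpp_at {a b b' c e : ℝ} (hb : 0 ≤ b) (hbb : b ≤ b') (he : 0 ≤ e) : fsN a b c e ≤ fsN a b' c e := by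
  have h := two_sq_mul_le_fsN_sub (a := a) (c := c) he hb hbb
  have : 0 ≤ 2 * a ^ 2 * (b' - b) := mul_nonneg (by positivity) (by linarith)
  linarith

/-- `fsN` is non-decreasing in `t_pp′` at fixed energy in the regime `c′e ≤ t_pd²` (`c ≤ c′`, `e ≥ 0`). [folklore] -/
theorem fsN_mono_tppP_at {a b c c' e : ℝ} (hcc : c ≤ c') (he : 0 ≤ e) (hreg : c' * e ≤ a ^ 2) : fsN a b c e ≤ fsN a b c' e := by
  rw [fsN_eq_mul, fsN_eq_mul]
  have hkey : (c' + b) * (2 * a ^ 2 + e * (b - c')) - (c + b) * (2 * a ^ 2 + e * (b - c)) = (c' - c) * (2 * a ^ 2 - e * (c + c')) := by ring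
  have h1 : 0 ≤ 2 * a ^ 2 - e * (c + c') := by nlinarith
  have : 0 ≤ (c' - c) * (2 * a ^ 2 - e * (c + c')) := mul_nonneg (by linarith) h1
  linarith

/-- **LOWER BOUND OF THE DISCRIMINANT OVER A `(t_pp, t_pp′)`-BOX at equal energies `(p, p)`**: for `b ∈ [b₁, b₂]`, `c ∈ [c₁, c₂]` (`0 ≤ b₁`, `0 ≤ c₁`, `c₂ ≤ b₁`,
`c₂Δ ≤ a²`, `Δ, p ≥ 0`): `a²[(b₁² − c₂²)Δ − 2(c₂ + b₂)(a² − c₁Δ) + 4c₁(c₁ + b₁)p] + c₁(b₁² − c₂²)p² ≤ dopingDisc(Δ, a, b, c; p, p)`. [folklore] -/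
theorem dopingDisc_ge_boxLower {Δ a b c b₁ b₂ c₁ c₂ p : ℝ} (hΔ : 0 ≤ Δ) (hb₁ : 0 ≤ b₁) (hc₁ : 0 ≤ c₁) (hb : b ∈ Icc b₁ b₂) (hc : c ∈ Icc c₁ c₂)
    (hcb : c₂ ≤ b₁) (hcap : c₂ * Δ ≤ a ^ 2) (hp : 0 ≤ p) :
    a ^ 2 * ((b₁ ^ 2 - c₂ ^ 2) * Δ - 2 * (c₂ + b₂) * (a ^ 2 - c₁ * Δ) + 4 * c₁ * (c₁ + b₁) * p) + c₁ * (b₁ ^ 2 - c₂ ^ 2) * p ^ 2 ≤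
      dopingDisc Δ a b c p p := by
  obtain ⟨hbl, hbu⟩ := hb
  obtain ⟨hcl, hcu⟩ := hc
  have hb0 : 0 ≤ b := hb₁.trans hbl
  have hc0 : 0 ≤ c := hc₁.trans hcl
  have ha2 : 0 ≤ a ^ 2 := sq_nonneg a
  unfold dopingDisc
  have t1 : (b₁ ^ 2 - c₂ ^ 2) * Δ ≤ (b ^ 2 - c ^ 2) * Δ := by
    apply mul_le_mul_of_nonneg_right _ hΔ; nlinarith
  have t2 : (c + b) * (a ^ 2 - c * Δ) ≤ (c₂ + b₂) * (a ^ 2 - c₁ * Δ) := by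
    have h1 : 0 ≤ c + b := by linarith
    have h3 : 0 ≤ a ^ 2 - c * Δ := by nlinarith
    exact mul_le_mul (by linarith) (by nlinarith) h3 (by linarith)
  have t3 : 4 * c₁ * (c₁ + b₁) * p ≤ 2 * c * (c + b) * (p + p) := by
    have h1 : c₁ * (c₁ + b₁) ≤ c * (c + b) := mul_le_mul hcl (by linarith) (by linarith) hc0
    nlinarith [mul_le_mul_of_nonneg_right h1 hp]
  have t4 : c₁ * (b₁ ^ 2 - c₂ ^ 2) * p ^ 2 ≤ c * (b ^ 2 - c ^ 2) * (p * p) := by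
    have h0 : 0 ≤ b₁ ^ 2 - c₂ ^ 2 := by nlinarith
    have h1 : b₁ ^ 2 - c₂ ^ 2 ≤ b ^ 2 - c ^ 2 := by nlinarith
    have h2 : c₁ * (b₁ ^ 2 - c₂ ^ 2) ≤ c * (b ^ 2 - c ^ 2) := mul_le_mul hcl h1 h0 hc0
    rw [pow_two p]
    exact mul_le_mul_of_nonneg_right h2 (mul_nonneg hp hp)
  have tsum : (b₁ ^ 2 - c₂ ^ 2) * Δ - 2 * (c₂ + b₂) * (a ^ 2 - c₁ * Δ) + 4 * c₁ * (c₁ + b₁) * p ≤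
      (b ^ 2 - c ^ 2) * Δ - 2 * (c + b) * (a ^ 2 - c * Δ) + 2 * c * (c + b) * (p + p) := by linarith
  have := mul_le_mul_of_nonneg_left tsum ha2
  linarith

/-- `ε_F` is non-decreasing in `t_pp`, endpoint form, certificate-free. [folklore] -/
theorem fermiEnergyOf_mono_tpp' {Δ a b b' c ν : ℝ} (hΔ : 0 < Δ) (ha : a ≠ 0) (hc : 0 ≤ c) (hb : 0 ≤ b) (hbb : b ≤ b') (hν0 : 0 < ν) (hν1 : ν < 1) :
    fermiEnergyOf Δ a b c ν ≤ fermiEnergyOf Δ a b' c ν := by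
  obtain ⟨e1, -, he1⟩ := exists_fermiEnergy_of_mem_Ioo hΔ ha hc hb hν0 hν1
  obtain ⟨e2, -, he2⟩ := exists_fermiEnergy_of_mem_Ioo hΔ ha hc (hb.trans hbb) hν0 hν1
  exact fermiEnergyOf_mono_tpp hΔ.le hc hb hbb hν0 hν1 ⟨e1, he1⟩ ⟨e2, he2⟩

/-! ## §2 The lower true corner -/

/-- **LOWER TRUE CORNER**: `R(Δ₁, a₁, b₂, c₂) ≤ R(θ)` for every member, under the window, the regime and the two closed-form margins. [folklore] -/
theorem fsRatio_fermiEnergyOf_trueCorner_lower {Δ a b c Δ₁ a₁ b₁ b₂ c₁ c₂ ν pL qL Mb Mc : ℝ} (hΔ₁ : 0 < Δ₁) (hΔ : Δ₁ ≤ Δ) (ha₁ : 0 < a₁) (ha : a₁ ≤ a)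
    (hb₁ : 0 < b₁) (hb : b ∈ Icc b₁ b₂) (hc₁ : 0 ≤ c₁) (hc : c ∈ Icc c₁ c₂) (hc₂b : c₂ ≤ b₁) (hν0 : 0 < ν) (hν1 : ν < 1)
    (hp0 : 0 ≤ pL) (hpL : pL ≤ fermiEnergyOf Δ₁ a₁ b₁ c₂ ν) (hqL : fermiEnergyOf Δ₁ a₁ b₂ c₁ ν ≤ qL) (hcapw : c₂ * (Δ₁ + 2 * qL) ≤ a₁ ^ 2)
    (hTmin : 0 ≤ fsD Δ₁ a₁ c₂ pL + 2 * fsN a₁ b₂ c₁ pL)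
    (hMb0 : 0 ≤ Mb) (hMb : -Mb ≤ a₁ ^ 2 * ((b₂ ^ 2 - c₂ ^ 2) * Δ₁ - 2 * (c₂ + b₂) * (a₁ ^ 2 - c₁ * Δ₁) + 4 * c₁ * (c₁ + b₂) * pL) + c₁ * (b₂ ^ 2 - c₂ ^ 2) * pL ^ 2)
    (hmb : 4 * Mb * (fsD Δ₁ a₁ c₁ qL + 2 * fsN a₁ b₂ c₂ qL) ^ 2 ≤
      2 * a₁ ^ 2 * ((Δ₁ + pL) * (a₁ ^ 2 - c₂ * qL)) * (fsD Δ₁ a₁ c₂ pL + 2 * fsN a₁ b₂ c₁ pL) ^ 2)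
    (hMc0 : 0 ≤ Mc) (hMc : dopingDisc Δ₁ a₁ b₂ c₂ qL qL ≤ Mc)
    (hmc : 4 * Mc * ((fsD Δ₁ a₁ c₁ qL + 2 * fsN a₁ b₂ c₂ qL) * (fsD Δ₁ a₁ c₂ qL + 2 * fsN a₁ b₂ c₂ qL)) ≤
      (((Δ₁ + pL) * (a₁ ^ 2 - c₂ * qL)) * (2 * a₁ ^ 2 - 2 * c₂ * qL) + fsN a₁ b₂ c₁ pL * ((Δ₁ + pL) * pL)) * (fsD Δ₁ a₁ c₂ pL + 2 * fsN a₁ b₂ c₂ pL) ^ 2) :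
    fsRatio Δ₁ a₁ b₂ c₂ (fermiEnergyOf Δ₁ a₁ b₂ c₂ ν) ≤ fsRatio Δ a b c (fermiEnergyOf Δ a b c ν) := by
  obtain ⟨hbl, hbu⟩ := hb
  obtain ⟨hcl, hcu⟩ := hc
  have hb0 : 0 < b := lt_of_lt_of_le hb₁ hbl
  have hb₂ : 0 < b₂ := lt_of_lt_of_le hb0 hbu
  have hc0 : 0 ≤ c := hc₁.trans hcl
  have hc₂ : 0 ≤ c₂ := hc0.trans hcu
  have hcb : c ≤ b := hcu.trans (hc₂b.trans hbl)
  have hcb₂ : c ≤ b₂ := hcb.trans hbu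
  have hc₂b₂ : c₂ ≤ b₂ := hc₂b.trans (hbl.trans hbu)
  have ha0 : 0 < a := lt_of_lt_of_le ha₁ ha
  have hpq : pL ≤ qL := hpL.trans ((fermiEnergyOf_mono_tpp' hΔ₁ ha₁.ne' hc₂ hb₁.le (hbl.trans hbu) hν0 hν1).trans
    ((fermiEnergyOf_anti_tppP' hΔ₁ ha₁.ne' hc₁ (hcl.trans hcu) hb₂.le hν0 hν1).trans hqL))
  have hq0 : 0 ≤ qL := hp0.trans hpq
  have hΔq : 0 ≤ Δ₁ + qL := by linarith only [hΔ₁, hq0]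
  have hΔp : 0 ≤ Δ₁ + pL := by linarith only [hΔ₁, hp0]
  have hreg₂ : c₂ * qL ≤ a₁ ^ 2 := le_trans (mul_le_mul_of_nonneg_left (by linarith only [hΔ₁, hq0]) hc₂) hcapw
  have hregc : c * qL ≤ a₁ ^ 2 := le_trans (mul_le_mul_of_nonneg_right hcu hq0) hreg₂
  have hregcp : c * pL ≤ a₁ ^ 2 := le_trans (mul_le_mul_of_nonneg_left hpq hc0) hregc
  have hreg₂p : c₂ * pL ≤ a₁ ^ 2 := le_trans (mul_le_mul_of_nonneg_left hpq hc₂) hreg₂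
  -- Fermi energies of the rows of the chain, inside the window
  have hE_bc : pL ≤ fermiEnergyOf Δ₁ a₁ b c ν :=
    hpL.trans ((fermiEnergyOf_mono_tpp' hΔ₁ ha₁.ne' hc₂ hb₁.le hbl hν0 hν1).trans (fermiEnergyOf_anti_tppP' hΔ₁ ha₁.ne' hc0 hcu hb0.le hν0 hν1))
  have hE_b₂c_lo : pL ≤ fermiEnergyOf Δ₁ a₁ b₂ c ν := hE_bc.trans (fermiEnergyOf_mono_tpp' hΔ₁ ha₁.ne' hc0 hb0.le hbu hν0 hν1)
  have hE_b₂c_hi : fermiEnergyOf Δ₁ a₁ b₂ c ν ≤ qL := (fermiEnergyOf_anti_tppP' hΔ₁ ha₁.ne' hc₁ hcl hb₂.le hν0 hν1).trans hqL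
  have hE_bc_hi : fermiEnergyOf Δ₁ a₁ b c ν ≤ qL := (fermiEnergyOf_mono_tpp' hΔ₁ ha₁.ne' hc0 hb0.le hbu hν0 hν1).trans hE_b₂c_hi
  have hE_V_lo : pL ≤ fermiEnergyOf Δ₁ a₁ b₂ c₂ ν := hpL.trans (fermiEnergyOf_mono_tpp' hΔ₁ ha₁.ne' hc₂ hb₁.le (hbl.trans hbu) hν0 hν1)
  have hc₁b₂ : c₁ ≤ b₂ := hcl.trans hcb₂
  have hcapΔ : c₂ * Δ₁ ≤ a₁ ^ 2 := le_trans (mul_le_mul_of_nonneg_left (by linarith only [hq0]) hc₂) hcapw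
  have hcapw_c : c * (Δ₁ + 2 * qL) ≤ a₁ ^ 2 := le_trans (mul_le_mul_of_nonneg_right hcu (by linarith only [hΔ₁, hq0])) hcapw
  -- monotone bounds of the weights on the slab
  have hD_c_q : fsD Δ₁ a₁ c qL ≤ fsD Δ₁ a₁ c₁ qL := fsD_anti_tppP_at hcl hq0 hΔq
  have hD_c₂_q : fsD Δ₁ a₁ c₂ qL ≤ fsD Δ₁ a₁ c₁ qL := fsD_anti_tppP_at (hcl.trans hcu) hq0 hΔq
  have hN_bc_q : fsN a₁ b c qL ≤ fsN a₁ b₂ c₂ qL := (fsN_mono_tpp_at hb0.le hbu hq0).trans (fsN_mono_tppP_at hcu hq0 hreg₂)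
  have hN_b₂c_q : fsN a₁ b₂ c qL ≤ fsN a₁ b₂ c₂ qL := fsN_mono_tppP_at hcu hq0 hreg₂
  have hD_c_p : fsD Δ₁ a₁ c₂ pL ≤ fsD Δ₁ a₁ c pL := fsD_anti_tppP_at hcu hp0 hΔp
  have hN_b₂c_p : fsN a₁ b₂ c₁ pL ≤ fsN a₁ b₂ c pL := fsN_mono_tppP_at hcl hp0 hregcp
  have hTmax_bc : fsD Δ₁ a₁ c qL + 2 * fsN a₁ b c qL ≤ fsD Δ₁ a₁ c₁ qL + 2 * fsN a₁ b₂ c₂ qL := by linarith only [hD_c_q, hN_bc_q]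
  have hTmax_b₂c : fsD Δ₁ a₁ c qL + 2 * fsN a₁ b₂ c qL ≤ fsD Δ₁ a₁ c₁ qL + 2 * fsN a₁ b₂ c₂ qL := by linarith only [hD_c_q, hN_b₂c_q]
  have hTmin_b₂c : fsD Δ₁ a₁ c₂ pL + 2 * fsN a₁ b₂ c₁ pL ≤ fsD Δ₁ a₁ c pL + 2 * fsN a₁ b₂ c pL := by linarith only [hD_c_p, hN_b₂c_p]
  have hTmax_V : fsD Δ₁ a₁ c₂ qL + 2 * fsN a₁ b₂ c₂ qL ≤ fsD Δ₁ a₁ c₁ qL + 2 * fsN a₁ b₂ c₂ qL := by linarith only [hD_c₂_q]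
  -- nonnegativity of the T's that get squared / multiplied
  have hNpos_b₂c₂_p : 0 < fsN a₁ b₂ c₂ pL := fsN_pos ha₁.ne' hc₂ hc₂b₂ hb₂ hp0
  have hD_c₂_p0 : 0 ≤ fsD Δ₁ a₁ c₂ pL := by unfold fsD; exact mul_nonneg hΔp (by linarith only [hreg₂p])
  have hT_V_p : 0 < fsD Δ₁ a₁ c₂ pL + 2 * fsN a₁ b₂ c₂ pL := by linarith only [hNpos_b₂c₂_p, hD_c₂_p0]
  have hT_bc_q0 : 0 ≤ fsD Δ₁ a₁ c qL + 2 * fsN a₁ b c qL := by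
    have h1 : 0 ≤ fsD Δ₁ a₁ c qL := by unfold fsD; exact mul_nonneg hΔq (by linarith only [hregc])
    have h2 := fsN_pos ha₁.ne' hc0 hcb hb0 hq0
    linarith only [h1, h2]
  have hT_b₂c_q0 : 0 ≤ fsD Δ₁ a₁ c qL + 2 * fsN a₁ b₂ c qL := by
    have h1 : 0 ≤ fsD Δ₁ a₁ c qL := by unfold fsD; exact mul_nonneg hΔq (by linarith only [hregc])
    have h2 := fsN_pos ha₁.ne' hc0 hcb₂ hb₂ hq0
    linarith only [h1, h2]
  have hT_V_q0 : 0 ≤ fsD Δ₁ a₁ c₂ qL + 2 * fsN a₁ b₂ c₂ qL := by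
    have h1 : 0 ≤ fsD Δ₁ a₁ c₂ qL := by unfold fsD; exact mul_nonneg hΔq (by linarith only [hreg₂])
    have h2 := fsN_pos ha₁.ne' hc₂ hc₂b₂ hb₂ hq0
    linarith only [h1, h2]
  have hTmax0 : 0 ≤ fsD Δ₁ a₁ c₁ qL + 2 * fsN a₁ b₂ c₂ qL := hT_V_q0.trans hTmax_V
  have hD0 : 0 ≤ (Δ₁ + pL) * (a₁ ^ 2 - c₂ * qL) := mul_nonneg hΔp (by linarith only [hreg₂])
  -- STEP 1 (margin t_pp′ lever at fixed (Δ₁, a₁, b₂): c → c₂)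
  have s1 : fsRatio Δ₁ a₁ b₂ c₂ (fermiEnergyOf Δ₁ a₁ b₂ c₂ ν) ≤ fsRatio Δ₁ a₁ b₂ c (fermiEnergyOf Δ₁ a₁ b₂ c ν) := by
    refine fsRatio_fermiEnergyOf_anti_tppP_of_margin (p := pL) (q := qL) (M := Mc) hΔ₁ ha₁ hb₂ hc0 hcu hc₂b₂ hν0 hν1 hp0 hE_V_lo hE_b₂c_hi
      hcapw hMc0 hMc ?_
    -- margin: 4Mc·T(b₂,c;q)·T(V;q) ≤ K(c)·T(V;p)²  from hmc
    have hK : ((Δ₁ + pL) * (a₁ ^ 2 - c₂ * qL)) * (2 * a₁ ^ 2 - 2 * c₂ * qL) + fsN a₁ b₂ c₁ pL * ((Δ₁ + pL) * pL) ≤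
        ((Δ₁ + pL) * (a₁ ^ 2 - c * qL)) * (2 * a₁ ^ 2 - 2 * c₂ * qL) + fsN a₁ b₂ c pL * ((Δ₁ + pL) * pL) := by
      have h1 : (Δ₁ + pL) * (a₁ ^ 2 - c₂ * qL) ≤ (Δ₁ + pL) * (a₁ ^ 2 - c * qL) :=
        mul_le_mul_of_nonneg_left (by nlinarith only [hcu, hq0]) hΔp
      have h2 : 0 ≤ 2 * a₁ ^ 2 - 2 * c₂ * qL := by linarith only [hreg₂]
      have h3 := mul_le_mul_of_nonneg_right h1 h2
      have h4 := mul_le_mul_of_nonneg_right hN_b₂c_p (mul_nonneg hΔp hp0)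
      linarith only [h3, h4]
    have hL : 4 * Mc * ((fsD Δ₁ a₁ c qL + 2 * fsN a₁ b₂ c qL) * (fsD Δ₁ a₁ c₂ qL + 2 * fsN a₁ b₂ c₂ qL)) ≤
        4 * Mc * ((fsD Δ₁ a₁ c₁ qL + 2 * fsN a₁ b₂ c₂ qL) * (fsD Δ₁ a₁ c₂ qL + 2 * fsN a₁ b₂ c₂ qL)) :=
      mul_le_mul_of_nonneg_left (mul_le_mul_of_nonneg_right hTmax_b₂c hT_V_q0) (by linarith only [hMc0])
    have hR := mul_le_mul_of_nonneg_right hK (sq_nonneg (fsD Δ₁ a₁ c₂ pL + 2 * fsN a₁ b₂ c₂ pL))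
    exact hL.trans (hmc.trans hR)
  -- STEP 2 (margin t_pp lever at fixed (Δ₁, a₁, c): b → b₂)
  have s2 : fsRatio Δ₁ a₁ b₂ c (fermiEnergyOf Δ₁ a₁ b₂ c ν) ≤ fsRatio Δ₁ a₁ b c (fermiEnergyOf Δ₁ a₁ b c ν) := by
    have hMb' : -Mb ≤ dopingDisc Δ₁ a₁ b₂ c pL pL :=
      hMb.trans (dopingDisc_ge_boxLower (b₁ := b₂) (b₂ := b₂) hΔ₁.le hb₂.le hc₁ ⟨le_rfl, le_rfl⟩ ⟨hcl, hcu⟩ hc₂b₂ hcapΔ hp0)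
    refine fsRatio_fermiEnergyOf_anti_tpp_of_margin (p := pL) (q := qL) (M := Mb) hΔ₁ ha₁ hb0 hbu hc0 hcb hν0 hν1 hp0 hE_bc hE_b₂c_hi
      hcapw_c hMb0 hMb' ?_
    -- margin: 4Mb·T(b,c;q)·T(b₂,c;q) ≤ 2a₁²(Δ₁+p)(a₁²−cq)·T(b₂,c;p)²  from hmb
    have hL : 4 * Mb * ((fsD Δ₁ a₁ c qL + 2 * fsN a₁ b c qL) * (fsD Δ₁ a₁ c qL + 2 * fsN a₁ b₂ c qL)) ≤
        4 * Mb * (fsD Δ₁ a₁ c₁ qL + 2 * fsN a₁ b₂ c₂ qL) ^ 2 := by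
      rw [pow_two]
      exact mul_le_mul_of_nonneg_left (mul_le_mul hTmax_bc hTmax_b₂c hT_b₂c_q0 hTmax0) (by linarith only [hMb0])
    have hcq : a₁ ^ 2 - c₂ * qL ≤ a₁ ^ 2 - c * qL := by nlinarith only [hcu, hq0]
    have hD : 2 * a₁ ^ 2 * ((Δ₁ + pL) * (a₁ ^ 2 - c₂ * qL)) ≤ 2 * a₁ ^ 2 * ((Δ₁ + pL) * (a₁ ^ 2 - c * qL)) :=
      mul_le_mul_of_nonneg_left (mul_le_mul_of_nonneg_left hcq hΔp) (by positivity)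
    have hT2 : (fsD Δ₁ a₁ c₂ pL + 2 * fsN a₁ b₂ c₁ pL) ^ 2 ≤ (fsD Δ₁ a₁ c pL + 2 * fsN a₁ b₂ c pL) ^ 2 :=
      pow_le_pow_left₀ hTmin hTmin_b₂c 2
    have hD0' : 0 ≤ 2 * a₁ ^ 2 * ((Δ₁ + pL) * (a₁ ^ 2 - c * qL)) := le_trans (mul_nonneg (by positivity) hD0) hD
    have hR := mul_le_mul hD hT2 (sq_nonneg _) hD0'
    exact hL.trans (hmb.trans hR)
  -- STEP 3 (t_pd lever a₁ → a at (Δ₁, ·, b, c)) and STEP 4 (Δ lever Δ₁ → Δ at (·, a, b, c))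
  have hreg₁ : c * fermiEnergyOf Δ₁ a₁ b c ν ≤ a₁ ^ 2 := le_trans (mul_le_mul_of_nonneg_left hE_bc_hi hc0) hregc
  have s3 : fsRatio Δ₁ a₁ b c (fermiEnergyOf Δ₁ a₁ b c ν) ≤ fsRatio Δ₁ a b c (fermiEnergyOf Δ₁ a b c ν) :=
    fsRatio_fermiEnergyOf_mono_tpd' hΔ₁ ha₁ ha hb0 hc0 hcb hν0 hν1 hreg₁
  have s4 : fsRatio Δ₁ a b c (fermiEnergyOf Δ₁ a b c ν) ≤ fsRatio Δ a b c (fermiEnergyOf Δ a b c ν) :=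
    fsRatio_fermiEnergyOf_mono_Delta' hΔ₁ hΔ ha0.ne' hb0 hc0 hcb hν0 hν1 (sheetRegime_mono_tpd' hΔ₁ ha₁ ha hc0 hb0.le hν0 hν1 hreg₁)
  exact s1.trans (s2.trans (s3.trans s4))

/-! ## §3 The upper true corner -/

/-- **UPPER TRUE CORNER**: `R(θ) ≤ R(Δ₂, a₂, b₁, c₁)` for every member, under the upper window, the box top, the regime and the two closed-form margins.
[folklore] -/
theorem fsRatio_fermiEnergyOf_trueCorner_upper {Δ a b c Δ₁ Δ₂ a₁ a₂ b₁ b₂ c₁ c₂ ν pU qU qT Mb Mc : ℝ} (hΔ₁ : 0 < Δ₁) (hΔ : Δ ∈ Icc Δ₁ Δ₂)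
    (ha₁ : 0 < a₁) (ha : a ∈ Icc a₁ a₂) (hb₁ : 0 < b₁) (hb : b ∈ Icc b₁ b₂) (hc₁ : 0 ≤ c₁) (hc : c ∈ Icc c₁ c₂) (hc₂b : c₂ ≤ b₁)
    (hν0 : 0 < ν) (hν1 : ν < 1)
    (hqT : fermiEnergyOf Δ₁ a₂ b₂ c₁ ν ≤ qT) (hregT : c₂ * qT ≤ a₁ ^ 2)
    (hp0 : 0 ≤ pU) (hpU : pU ≤ fermiEnergyOf Δ₂ a₂ b₁ c₂ ν) (hqU : fermiEnergyOf Δ₂ a₂ b₂ c₁ ν ≤ qU) (hcapw : c₂ * (Δ₂ + 2 * qU) ≤ a₂ ^ 2)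
    (hTmin : 0 ≤ fsD Δ₂ a₂ c₂ pU + 2 * fsN a₂ b₁ c₁ pU)
    (hMb0 : 0 ≤ Mb) (hMb : -Mb ≤ a₂ ^ 2 * ((b₁ ^ 2 - c₂ ^ 2) * Δ₂ - 2 * (c₂ + b₂) * (a₂ ^ 2 - c₁ * Δ₂) + 4 * c₁ * (c₁ + b₁) * pU) + c₁ * (b₁ ^ 2 - c₂ ^ 2) * pU ^ 2)
    (hmb : 4 * Mb * (fsD Δ₂ a₂ c₁ qU + 2 * fsN a₂ b₂ c₂ qU) ^ 2 ≤
      2 * a₂ ^ 2 * ((Δ₂ + pU) * (a₂ ^ 2 - c₂ * qU)) * (fsD Δ₂ a₂ c₂ pU + 2 * fsN a₂ b₁ c₁ pU) ^ 2)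
    (hMc0 : 0 ≤ Mc) (hMc : a₂ ^ 2 * (b₁ ^ 2 * Δ₂ - 2 * (c₁ + b₁) * (a₂ ^ 2 - c₂ * Δ₂) + 4 * c₂ * (c₂ + b₁) * qU) + c₂ * b₁ ^ 2 * qU ^ 2 ≤ Mc)
    (hmc : 4 * Mc * ((fsD Δ₂ a₂ c₁ qU + 2 * fsN a₂ b₁ c₁ qU) * (fsD Δ₂ a₂ c₁ qU + 2 * fsN a₂ b₁ c₂ qU)) ≤
      (((Δ₂ + pU) * (a₂ ^ 2 - c₁ * qU)) * (2 * a₂ ^ 2 - 2 * c₂ * qU) + fsN a₂ b₁ c₁ pU * ((Δ₂ + pU) * pU)) * (fsD Δ₂ a₂ c₂ pU + 2 * fsN a₂ b₁ c₁ pU) ^ 2) :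
    fsRatio Δ a b c (fermiEnergyOf Δ a b c ν) ≤ fsRatio Δ₂ a₂ b₁ c₁ (fermiEnergyOf Δ₂ a₂ b₁ c₁ ν) := by
  obtain ⟨hΔl, hΔu⟩ := hΔ
  obtain ⟨hal, hau⟩ := ha
  obtain ⟨hbl, hbu⟩ := hb
  obtain ⟨hcl, hcu⟩ := hc
  have hΔ0 : 0 < Δ := lt_of_lt_of_le hΔ₁ hΔl
  have hΔ₂ : 0 < Δ₂ := lt_of_lt_of_le hΔ0 hΔu
  have ha0 : 0 < a := lt_of_lt_of_le ha₁ hal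
  have ha₂ : 0 < a₂ := lt_of_lt_of_le ha0 hau
  have hb0 : 0 < b := lt_of_lt_of_le hb₁ hbl
  have hb₂ : 0 < b₂ := lt_of_lt_of_le hb0 hbu
  have hc0 : 0 ≤ c := hc₁.trans hcl
  have hc₂ : 0 ≤ c₂ := hc0.trans hcu
  have hcb₁ : c ≤ b₁ := hcu.trans hc₂b
  have hcb : c ≤ b := hcb₁.trans hbl
  have hc₁b₁ : c₁ ≤ b₁ := hcl.trans hcb₁
  -- window facts
  have hpq : pU ≤ qU := hpU.trans ((fermiEnergyOf_mono_tpp' hΔ₂ ha₂.ne' hc₂ hb₁.le (hbl.trans hbu) hν0 hν1).trans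
    ((fermiEnergyOf_anti_tppP' hΔ₂ ha₂.ne' hc₁ (hcl.trans hcu) hb₂.le hν0 hν1).trans hqU))
  have hq0 : 0 ≤ qU := hp0.trans hpq
  have hΔq : 0 ≤ Δ₂ + qU := by linarith only [hΔ₂, hq0]
  have hΔp : 0 ≤ Δ₂ + pU := by linarith only [hΔ₂, hp0]
  have hreg₂ : c₂ * qU ≤ a₂ ^ 2 := le_trans (mul_le_mul_of_nonneg_left (by linarith only [hΔ₂, hq0]) hc₂) hcapw
  have hregc : c * qU ≤ a₂ ^ 2 := le_trans (mul_le_mul_of_nonneg_right hcu hq0) hreg₂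
  have hreg₂p : c₂ * pU ≤ a₂ ^ 2 := le_trans (mul_le_mul_of_nonneg_left hpq hc₂) hreg₂
  have hregcp : c * pU ≤ a₂ ^ 2 := le_trans (mul_le_mul_of_nonneg_right hcu hp0) hreg₂p
  have hcapΔ : c₂ * Δ₂ ≤ a₂ ^ 2 := le_trans (mul_le_mul_of_nonneg_left (by linarith only [hq0]) hc₂) hcapw
  have hcapw_c : c * (Δ₂ + 2 * qU) ≤ a₂ ^ 2 := le_trans (mul_le_mul_of_nonneg_right hcu (by linarith only [hΔ₂, hq0])) hcapw
  -- the rows of the upper chain and their Fermi energies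
  have hE_b₁c : pU ≤ fermiEnergyOf Δ₂ a₂ b₁ c ν := hpU.trans (fermiEnergyOf_anti_tppP' hΔ₂ ha₂.ne' hc0 hcu hb₁.le hν0 hν1)
  have hE_bc_hi : fermiEnergyOf Δ₂ a₂ b c ν ≤ qU :=
    ((fermiEnergyOf_anti_tppP' hΔ₂ ha₂.ne' hc₁ hcl hb0.le hν0 hν1).trans (fermiEnergyOf_mono_tpp' hΔ₂ ha₂.ne' hc₁ hb0.le hbu hν0 hν1)).trans hqU
  have hE_b₁c₁_hi : fermiEnergyOf Δ₂ a₂ b₁ c₁ ν ≤ qU := (fermiEnergyOf_mono_tpp' hΔ₂ ha₂.ne' hc₁ hb₁.le (hbl.trans hbu) hν0 hν1).trans hqU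
  -- the regime at the member and at (Δ₂, a, b, c) from the box top
  have hEtop : fermiEnergyOf Δ a b c ν ≤ qT :=
    (fermiEnergyOf_mem_Icc_of_mem_box' (c₂ := c) hΔ₁ ha₁ hb₁.le hc₁ ⟨hΔl, hΔu⟩ ⟨hal, hau⟩ ⟨hbl, hbu⟩ ⟨hcl, le_rfl⟩ hν0 hν1).2.trans hqT
  have hreg_mem : c * fermiEnergyOf Δ a b c ν ≤ a ^ 2 := by
    have h1 : c * fermiEnergyOf Δ a b c ν ≤ c₂ * qT := mul_le_mul hcu hEtop (fermiEnergyOf_pos hΔ0 ha0.ne' hc0 hb0.le hν0 hν1).le hc₂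
    have h2 : a₁ ^ 2 ≤ a ^ 2 := pow_le_pow_left₀ ha₁.le hal 2
    linarith only [h1, hregT, h2]
  -- STEP 1 (Δ lever Δ → Δ₂) and STEP 2 (t_pd lever a → a₂)
  have s1 : fsRatio Δ a b c (fermiEnergyOf Δ a b c ν) ≤ fsRatio Δ₂ a b c (fermiEnergyOf Δ₂ a b c ν) :=
    fsRatio_fermiEnergyOf_mono_Delta' hΔ0 hΔu ha0.ne' hb0 hc0 hcb hν0 hν1 hreg_mem
  have hreg2 : c * fermiEnergyOf Δ₂ a b c ν ≤ a ^ 2 :=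
    le_trans (mul_le_mul_of_nonneg_left (fermiEnergyOf_anti_Delta' hΔ0 hΔu ha0.ne' hc0 hb0.le hν0 hν1) hc0) hreg_mem
  have s2 : fsRatio Δ₂ a b c (fermiEnergyOf Δ₂ a b c ν) ≤ fsRatio Δ₂ a₂ b c (fermiEnergyOf Δ₂ a₂ b c ν) :=
    fsRatio_fermiEnergyOf_mono_tpd' hΔ₂ ha0 hau hb0 hc0 hcb hν0 hν1 hreg2
  -- monotone bounds of the weights on the upper slab (Δ₂, a₂)
  have hD_c_q : fsD Δ₂ a₂ c qU ≤ fsD Δ₂ a₂ c₁ qU := fsD_anti_tppP_at hcl hq0 hΔq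
  have hN_bc_q : fsN a₂ b c qU ≤ fsN a₂ b₂ c₂ qU := (fsN_mono_tpp_at hb0.le hbu hq0).trans (fsN_mono_tppP_at hcu hq0 hreg₂)
  have hN_b₁c_q : fsN a₂ b₁ c qU ≤ fsN a₂ b₂ c₂ qU := (fsN_mono_tpp_at hb₁.le (hbl.trans hbu) hq0).trans (fsN_mono_tppP_at hcu hq0 hreg₂)
  have hN_b₁c_q' : fsN a₂ b₁ c qU ≤ fsN a₂ b₁ c₂ qU := fsN_mono_tppP_at hcu hq0 hreg₂
  have hD_c_p : fsD Δ₂ a₂ c₂ pU ≤ fsD Δ₂ a₂ c pU := fsD_anti_tppP_at hcu hp0 hΔp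
  have hN_bc_p : fsN a₂ b₁ c₁ pU ≤ fsN a₂ b c pU := (fsN_mono_tpp_at hb₁.le hbl hp0).trans (fsN_mono_tppP_at hcl hp0 hregcp)
  have hN_b₁c_p : fsN a₂ b₁ c₁ pU ≤ fsN a₂ b₁ c pU := fsN_mono_tppP_at hcl hp0 hregcp
  have hTmax_bc : fsD Δ₂ a₂ c qU + 2 * fsN a₂ b c qU ≤ fsD Δ₂ a₂ c₁ qU + 2 * fsN a₂ b₂ c₂ qU := by linarith only [hD_c_q, hN_bc_q]
  have hTmax_b₁c : fsD Δ₂ a₂ c qU + 2 * fsN a₂ b₁ c qU ≤ fsD Δ₂ a₂ c₁ qU + 2 * fsN a₂ b₂ c₂ qU := by linarith only [hD_c_q, hN_b₁c_q]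
  have hTmax1_b₁c : fsD Δ₂ a₂ c qU + 2 * fsN a₂ b₁ c qU ≤ fsD Δ₂ a₂ c₁ qU + 2 * fsN a₂ b₁ c₂ qU := by linarith only [hD_c_q, hN_b₁c_q']
  have hTmin_bc : fsD Δ₂ a₂ c₂ pU + 2 * fsN a₂ b₁ c₁ pU ≤ fsD Δ₂ a₂ c pU + 2 * fsN a₂ b c pU := by linarith only [hD_c_p, hN_bc_p]
  have hTmin_b₁c : fsD Δ₂ a₂ c₂ pU + 2 * fsN a₂ b₁ c₁ pU ≤ fsD Δ₂ a₂ c pU + 2 * fsN a₂ b₁ c pU := by linarith only [hD_c_p, hN_b₁c_p]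
  -- nonnegativity of the T's
  have hD_c_q0 : 0 ≤ fsD Δ₂ a₂ c qU := by unfold fsD; exact mul_nonneg hΔq (by linarith only [hregc])
  have hT_bc_q0 : 0 ≤ fsD Δ₂ a₂ c qU + 2 * fsN a₂ b c qU := by
    have h2 := fsN_pos ha₂.ne' hc0 hcb hb0 hq0; linarith only [hD_c_q0, h2]
  have hT_b₁c_q0 : 0 ≤ fsD Δ₂ a₂ c qU + 2 * fsN a₂ b₁ c qU := by
    have h2 := fsN_pos ha₂.ne' hc0 hcb₁ hb₁ hq0; linarith only [hD_c_q0, h2]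
  have hT_b₁c₁_q0 : 0 ≤ fsD Δ₂ a₂ c₁ qU + 2 * fsN a₂ b₁ c₁ qU := by
    have h1 : 0 ≤ fsD Δ₂ a₂ c₁ qU := hD_c_q0.trans hD_c_q
    have h2 := fsN_pos ha₂.ne' hc₁ hc₁b₁ hb₁ hq0; linarith only [h1, h2]
  have hTmax0 : 0 ≤ fsD Δ₂ a₂ c₁ qU + 2 * fsN a₂ b₂ c₂ qU := hT_bc_q0.trans hTmax_bc
  have hD0 : 0 ≤ (Δ₂ + pU) * (a₂ ^ 2 - c₂ * qU) := mul_nonneg hΔp (by linarith only [hreg₂])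
  have hD0₁ : 0 ≤ (Δ₂ + pU) * (a₂ ^ 2 - c₁ * qU) := mul_nonneg hΔp (by nlinarith only [hreg₂, hcl, hcu, hq0])
  -- STEP 3 (margin t_pp lever at fixed (Δ₂, a₂, c): b₁ → b, read as R(b) ≤ R(b₁))
  have s3 : fsRatio Δ₂ a₂ b c (fermiEnergyOf Δ₂ a₂ b c ν) ≤ fsRatio Δ₂ a₂ b₁ c (fermiEnergyOf Δ₂ a₂ b₁ c ν) := by
    have hMb' : -Mb ≤ dopingDisc Δ₂ a₂ b c pU pU :=
      hMb.trans (dopingDisc_ge_boxLower (b₁ := b₁) (b₂ := b₂) hΔ₂.le hb₁.le hc₁ ⟨hbl, hbu⟩ ⟨hcl, hcu⟩ hc₂b hcapΔ hp0)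
    refine fsRatio_fermiEnergyOf_anti_tpp_of_margin (p := pU) (q := qU) (M := Mb) hΔ₂ ha₂ hb₁ hbl hc0 hcb₁ hν0 hν1 hp0 hE_b₁c hE_bc_hi
      hcapw_c hMb0 hMb' ?_
    have hL : 4 * Mb * ((fsD Δ₂ a₂ c qU + 2 * fsN a₂ b₁ c qU) * (fsD Δ₂ a₂ c qU + 2 * fsN a₂ b c qU)) ≤
        4 * Mb * (fsD Δ₂ a₂ c₁ qU + 2 * fsN a₂ b₂ c₂ qU) ^ 2 := by
      rw [pow_two]
      exact mul_le_mul_of_nonneg_left (mul_le_mul hTmax_b₁c hTmax_bc hT_bc_q0 hTmax0) (by linarith only [hMb0])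
    have hcq : a₂ ^ 2 - c₂ * qU ≤ a₂ ^ 2 - c * qU := by nlinarith only [hcu, hq0]
    have hD : 2 * a₂ ^ 2 * ((Δ₂ + pU) * (a₂ ^ 2 - c₂ * qU)) ≤ 2 * a₂ ^ 2 * ((Δ₂ + pU) * (a₂ ^ 2 - c * qU)) :=
      mul_le_mul_of_nonneg_left (mul_le_mul_of_nonneg_left hcq hΔp) (by positivity)
    have hT2 : (fsD Δ₂ a₂ c₂ pU + 2 * fsN a₂ b₁ c₁ pU) ^ 2 ≤ (fsD Δ₂ a₂ c pU + 2 * fsN a₂ b c pU) ^ 2 :=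
      pow_le_pow_left₀ hTmin hTmin_bc 2
    have hD0' : 0 ≤ 2 * a₂ ^ 2 * ((Δ₂ + pU) * (a₂ ^ 2 - c * qU)) := le_trans (mul_nonneg (by positivity) hD0) hD
    have hR := mul_le_mul hD hT2 (sq_nonneg _) hD0'
    exact hL.trans (hmb.trans hR)
  -- STEP 4 (margin t_pp′ lever at fixed (Δ₂, a₂, b₁): c₁ → c, read as R(c) ≤ R(c₁))
  have s4 : fsRatio Δ₂ a₂ b₁ c (fermiEnergyOf Δ₂ a₂ b₁ c ν) ≤ fsRatio Δ₂ a₂ b₁ c₁ (fermiEnergyOf Δ₂ a₂ b₁ c₁ ν) := by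
    have hMc' : dopingDisc Δ₂ a₂ b₁ c qU qU ≤ Mc :=
      (dopingDisc_le_slabBound (c₁ := c₁) (c₂ := c₂) (e := qU) hΔ₂.le hb₁.le hc₁ ⟨hcl, hcu⟩ hc₂b hcapΔ ⟨hq0, le_rfl⟩ ⟨hq0, le_rfl⟩).trans hMc
    refine fsRatio_fermiEnergyOf_anti_tppP_of_margin (p := pU) (q := qU) (M := Mc) hΔ₂ ha₂ hb₁ hc₁ hcl hcb₁ hν0 hν1 hp0 hE_b₁c hE_b₁c₁_hi
      hcapw_c hMc0 hMc' ?_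
    have hK : ((Δ₂ + pU) * (a₂ ^ 2 - c₁ * qU)) * (2 * a₂ ^ 2 - 2 * c₂ * qU) + fsN a₂ b₁ c₁ pU * ((Δ₂ + pU) * pU) ≤
        ((Δ₂ + pU) * (a₂ ^ 2 - c₁ * qU)) * (2 * a₂ ^ 2 - 2 * c * qU) + fsN a₂ b₁ c₁ pU * ((Δ₂ + pU) * pU) := by
      have h1 : 2 * a₂ ^ 2 - 2 * c₂ * qU ≤ 2 * a₂ ^ 2 - 2 * c * qU := by nlinarith only [hcu, hq0]
      have h3 := mul_le_mul_of_nonneg_left h1 hD0₁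
      linarith only [h3]
    have hL : 4 * Mc * ((fsD Δ₂ a₂ c₁ qU + 2 * fsN a₂ b₁ c₁ qU) * (fsD Δ₂ a₂ c qU + 2 * fsN a₂ b₁ c qU)) ≤
        4 * Mc * ((fsD Δ₂ a₂ c₁ qU + 2 * fsN a₂ b₁ c₁ qU) * (fsD Δ₂ a₂ c₁ qU + 2 * fsN a₂ b₁ c₂ qU)) :=
      mul_le_mul_of_nonneg_left (mul_le_mul_of_nonneg_left hTmax1_b₁c hT_b₁c₁_q0) (by linarith only [hMc0])
    have hKnn : 0 ≤ ((Δ₂ + pU) * (a₂ ^ 2 - c₁ * qU)) * (2 * a₂ ^ 2 - 2 * c₂ * qU) + fsN a₂ b₁ c₁ pU * ((Δ₂ + pU) * pU) :=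
      add_nonneg (mul_nonneg hD0₁ (by linarith only [hreg₂])) (mul_nonneg (fsN_pos ha₂.ne' hc₁ hc₁b₁ hb₁ hp0).le (mul_nonneg hΔp hp0))
    have hT2 : (fsD Δ₂ a₂ c₂ pU + 2 * fsN a₂ b₁ c₁ pU) ^ 2 ≤ (fsD Δ₂ a₂ c pU + 2 * fsN a₂ b₁ c pU) ^ 2 :=
      pow_le_pow_left₀ hTmin hTmin_b₁c 2
    have hKnn' : 0 ≤ ((Δ₂ + pU) * (a₂ ^ 2 - c₁ * qU)) * (2 * a₂ ^ 2 - 2 * c * qU) + fsN a₂ b₁ c₁ pU * ((Δ₂ + pU) * pU) := hKnn.trans hK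
    have hR := mul_le_mul hK hT2 (sq_nonneg _) hKnn'
    exact hL.trans (hmc.trans hR)
  exact s1.trans (s2.trans (s3.trans s4))

end Summit.Ventures.CertifiedManyBodySolver.Downfold.Emery
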